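import Mathlib
import Literature.MathematicalPhysics.QuantumFieldTheory.Balaban1983to89.B9
import Literature.MathematicalPhysics.QuantumFieldTheory.Balaban1983to89.B6FromB4
import Literature.MathematicalPhysics.QuantumFieldTheory.Balaban1983to89.B4Sect5Torus

/-! # `Balaban1983to89.B9Thm315Decay` — Theorem 3.15's last step, *"The formula (3.185) implies immediately bounds and
# an exponential decay"*: the decay of the unit-lattice kernel of `QG̃₂Q*` passes through the local dressing `I + D̄μ`
# of (3.185) to `C^{(k)}(Λ)` with the SAME rate, (3.187); the kernel-level bookkeeping of (3.186); and the edge into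
# the typed Theorem 3.15 (`B9.Thm315Printed`) — kernel-checked, [folklore]

CITATION HEADER (lean-in-tree rule).  Paper sub-cell `b2b-balaban-b09` (gen 11, journal claim B9-THM315-DECAY, cell
pub-balaban) on T. Bałaban, *Propagators for lattice gauge theories in a background field*, Commun. Math. Phys. **99**
(1985) 389–434 [`Balaban1985BackgroundPropagators`] (= B9; held `paper:balaban1985-cmp99-background-propagators`;
journal page = PDF page + 388), Sect. E pp. 427–432 [PDF 39–44] (renders
`b2b-balaban-ref1/pages/1985-cmp99-background-propagators/1985-cmp99-background-propagators-p039-x2.png`, `…-p040-x2.png`,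
`…-p041-x2.png`, `…-p042-x2.png`, `…-p044-x2.png` READ AS IMAGES for this module, not from an OCR layer).  USED BY NAME,
nothing restated: `B6FromB4.sandwich_decay` (the generic three-factor sandwich over finite index sets with
positions in a pseudo-metric space — the B6 p. 250 sentence *"C is a short-ranged operator, so C*Δ_kC has the same
exponential decay as Δ_k"*), `B4Sect5Torus.IsPseudoDist`, r1's typed Theorem 3.15 `B9.Thm315Printed` with
its carriers `B9.Geometry`, `B9.Backgrounds`, `B9.SiteKernel`.  No existing module is modified.

WHAT IS PRINTED (verbatim).
* p. 427 [PDF 39], Sect. E: *"We need operators with Dirichlet boundary conditions outside some domain Λ of the unit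
  lattice. We assume that Λ ⊂ Λ_k = Ω_k^{(k)}, Λ is a union of big blocks, and a distance between Λ and Λ_k^c is bigger
  than RM. The covariances are defined by the following Gaussian integrals"* (3.155) *"where the operators are defined
  by the sequence {Ω_j} and a configuration U satisfying (3.35), (3.36), … and g is an arbitrary Lie algebra valued
  function defined at bonds of Λ."*
* p. 428 [PDF 40], (3.159): *"… × Z_k^{−1}∫dA δ(QA − B)δ_R(RD*A) × exp[−½⟨A,(Δ + Δ^{(2)})A⟩]"* (Q averages the fine
  field A to a field on the bonds of Λ).
* p. 429 [PDF 41]: *"We form a new sequence adding the set Ω_{k+1} = B^k(Λ). Let us denote operators constructed for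
  this sequence by a wavy line, e.g. G̃₁, H̃₁, Q̃, etc."*
* p. 430 [PDF 42]: *"we perform the gauge transformation B → B + D̄μ. … The δ-functions above determine μ uniquely as a
  linear function of B. Indeed, denoting V = Ū^k, we have for x ∈ B(y), y ∈ Λ′
  (R_y(V)(B + D̄μ))(Γ_{y,x}) = (R_y(V)B)(Γ_{y,x}) + R(V(Γ_{y,x}))μ(x) − μ(y) = 0, … This implies
  μ(y) = Q′(R_y(V)B)(Γ_{y,·}), μ(x) = R(V(Γ_{x,y}))Q′(R_y(V)B)(Γ_{y,·}) − R(V(Γ_{x,y}))(R_y(V)B)(Γ_{y,x}), x ∈ B(y), x ≠ y.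
  (3.169) We denote the linear function defined by the above formulas by μ(B)."*
* p. 432 [PDF 44]: *"Let us denote a covariance operator of the Gaussian integral in (3.183) by G̃₂, then we obtain
  C^{(k)}(Λ) = (I + D̄μ)QG̃₂Q*(I + μ*D̄*). (3.185) It is the formula we are looking for. … We have
  G̃₂ = G₂ − G₂Q̃*(Q̃G₂Q̃*)^{−1}Q̃G₂. (3.186) The operator G₂ differs from G₁ only by the small and regular operators
  connected with the second term in the exponential in (3.183), and with terms containing Dλ̃(A). Thus we can
  investigate the operator G₂ perturbatively in the same way as the operator G₁ in (3.138). The analysis is even simpler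
  because the new terms are more regular, as it follows easily from (3.184). This way we can express C^{(k)}(Λ) in terms
  of the operators of the type G′, (Q′G′²Q′*)^{−1}, G, (QGQ*)^{−1}. Expanding these into random walks we get a random
  walk expansion of C^{(k)}(Λ). The formula (3.185) implies immediately bounds and an exponential decay. Thus we get
  Theorem 3.15. For Mα₀ sufficiently small the propagator C^{(k)}(Λ) is given by the formula (3.185), and satisfies the
  bound |C^{(k)}(Λ; y, y′)| ≤ B₀e^{−δ₀|y−y′|}, y, y′ ∈ Λ (3.187) with the constants B₀, δ₀ depending on d and L only.
  This propagator has a convergent random walk expansion of the type described previously."*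

THE READING (typed objects; every choice is recorded in the cell's DIVERGENCE D-b09.39 — a typing, not a claim about
the print).
(a) THE CARRIER.  `P` = a finite index set standing for the pairs (bond of Λ) × (Lie-algebra component) on which g and
    C^{(k)}(Λ) live (p. 427), with a map `e : P → 𝔅` onto the sites marked `inΛ` of r1's `B9.Geometry` (r1 typed
    *"y, y′ ∈ Λ"* of (3.187) as sites with the predicate `inΛ` and the distance `unitDist` = |y − y′|); |y − y′|
    pulled back along e is assumed a pseudo-distance (`IsPseudoDist`: symmetric, zero on the diagonal, triangle).
(b) (3.185) AS A KERNEL IDENTITY on P: C^{(k)}(Λ)(e p, e q) = (E·S·Eᵀ)(p, q) with E = the matrix of I + D̄μ and S = the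
    matrix of QG̃₂Q* in the coordinates P; on the unit lattice the pairing ⟨B, g⟩ is the plain sum over P, so the
    adjoint (I + D̄μ)* = I + μ*D̄* is the transpose and matrix entries ARE kernels (no weights).
(c) LOCALITY OF I + D̄μ, from (3.169): μ(x) for x ∈ B(y) is a linear function of B restricted to the bonds of the contours
    Γ_{y,x′} ⊂ B(y), and D̄ has range one bond; hence E(b, b′) ≠ 0 ⇒ |b − b′| ≤ r and Σ_{b′}|E(b, b′)| ≤ m with r, m
    depending on d and L only.  The VALUES of r and m are NOT computed here: they are parameters of the statements.
(d) THE RANDOM-WALK INPUT is the kernel bound |S(p, q)| ≤ B₁e^{−δ₁|e p − e q|} of QG̃₂Q* — a HYPOTHESIS of printed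
    shape (*"Expanding these into random walks we get a random walk expansion of C^{(k)}(Λ)"*).  Its derivation — the
    perturbative analysis of G₂ (cell GAPS G-B9-10 (a)(b)(c) as refined by C-adv8-2: OPEN, not in print), the
    composition (3.186) through the block set 𝔅̃ of the extended sequence (§2 below gives its kernel-level bookkeeping
    over an arbitrary middle carrier with a lattice-sum profile; the multiscale instantiation with [4] Lemma 2.1 is by
    name `B6RandomWalk.hasMajorant_mul` / `B9Eq395Hom.conv_kernel_le`, not done here), the Q-sandwich majorant ⇒
    kernel passage (by name: `B9Eq395Hom.sandwich_majorant` + `B9Thm34Inv.hasMajorant_id_iff`,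
    `B6DomainMajorantSandwich.q_sandwich_majorant` + `entry_le_of_hasMajorant_id`), and the comparison of the distance of
    the extended sequence with |y − y′| (§1 `decay_of_affine_comparison` gives the shape) — is NOT instantiated here.
(e) CONSTANTS: δ₀ = δ₁ (the SAME rate — this certifies the transfer clause of the cell's C-adv8-2 *"μ(·) is bounded and
    local, so decay transfers from G̃₂ to C^{(k)}(Λ) with the same rate"*) and B₀ = B₁e^{2δ₁r}m²; *"depending on d and L
    only"* is inherited from B₁, δ₁, r, m.

WHAT THIS MODULE PROVES (kernel-checked; no `sorry`, no axiom beyond Lean's three):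
1. §1 `dressed_decay` — a kernel S with |S(u,v)| ≤ B₁e^{−δ₁ρ(u,v)} dressed by finite-range (≤ r) factors E (row ℓ¹-sums
   ≤ m_E) and F (column ℓ¹-sums ≤ m_F) satisfies |(ESF)(p,q)| ≤ B₁e^{2δ₁r}m_Em_F·e^{−δ₁ρ(p,q)} for any pseudo-distance ρ
   (`B6FromB4.sandwich_decay` under the pseudo-metric space generated by ρ); `decay_3187_of_3185` — the case F = Eᵀ of
   (3.185): |(ESEᵀ)(p,q)| ≤ B₁e^{2δ₁r}m²e^{−δ₁ρ(p,q)}; `decay_of_affine_comparison` — decay in ρ₁ passes to decay in ρ₂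
   along cρ₂ ≤ ρ₁ + a with rate cδ and constant ×e^{δa} (the shape of the distance comparison of reading (d)).
2. §2 `conv_le_left`, `conv_le_right` (Σ_z e^{−aρ(x,z)}e^{−bρ(z,y)} ≤ K·e^{−δ′ρ(x,y)} from a lattice-sum profile
   Σ_z e^{−(a−δ′)ρ(w,z)} ≤ K, resp. the profile at b − δ′, and the triangle inequality), `mul_decay` (the product of two
   decaying rectangular kernels through a middle carrier decays, given the convolution bound), `kernel_3186` — the
   kernel-level bookkeeping of (3.186) sandwiched by Q ⋯ Q*: if QG₂Q*, QG₂Q̃*, (Q̃G₂Q̃*)^{−1}, Q̃G₂Q* have kernels bounded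
   by c₁, c_A, c_H, c_B times e^{−δ·distance} (positions `pos` of P in the middle carrier W) and W has the profile K at
   the rate δ − δ′ (0 ≤ δ′ ≤ δ), then QG̃₂Q* = QG₂Q* − (QG₂Q̃*)(Q̃G₂Q̃*)^{−1}(Q̃G₂Q*) has kernel bounded by
   (c₁ + c_Ac_Hc_BK²)e^{−δ′ρ(pos p, pos q)}.
3. §3 `Rep3185` (the data of (3.185) at one configuration, readings (a)–(d), as ONE `Prop`), `bound_of_rep3185` (⇒ the
   inequality (3.187) at that configuration with (δ₁, B₁e^{2δ₁r}m²)), `Hyp3185` (the data under the quantifier prefix of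
   the typed Theorem 3.15: every instance i, every α₀ with Mα₀ ≤ a₀, every U with (3.35)–(3.36), with constants
   (δ₁, B₁, r, m) uniform in i and U), and THE EDGE `thm315Printed_of_3185 : Hyp3185 … a₀ δ₁ B₁ r m → B9.Thm315Printed …`
   (witnesses δ₀ = δ₁, a₀, B₀ = B₁e^{2δ₁r}m²).

WHAT IT DOES NOT PROVE (named hypotheses of printed shape, or not modelled): the random-walk expansions and the
perturbative analysis of G₂ behind the kernel bound of QG̃₂Q* (G-B9-10 (a)(b)(c), C-adv8-2 — OPEN); the estimate of the
G₂ − G₁ terms of (3.183)–(3.184); the lower bound γ₀ of p. 428 (G-B9-09); the δ-function manipulations (3.159)–(3.182)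
leading to (3.185) (G-B9-17; (3.185) enters as the identity of reading (b)); the values of r and m from (3.169); the
identification of the adjoints with transposes (reading (b)); the comparison of the extended-sequence distance with
|y − y′|; the clause *"This propagator has a convergent random walk expansion"* of Theorem 3.15 (r1's `Thm315Printed`
types the bound (3.187) only; the cell's `B9.Thm315FullPrinted` keeps that clause abstract).  Value = kernel certificate
of the printed last step of the proof of Theorem 3.15 and of the exact list of inputs it consumes — typed skeleton /
located gap, NOT summit progress.
-/

namespace Literature.MathematicalPhysics.QuantumFieldTheory.Balaban1983to89.B9Thm315Decay

open Finset
open scoped Matrix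
open B4Sect5Torus (IsPseudoDist)

/-! ## §1  (3.185) ⇒ (3.187): a local dressing of a decaying kernel decays at the same rate -/

section Dressing

variable {P : Type} [Fintype P]

/-- The pseudo-metric space generated by a pseudo-distance on an index set (used only inside proofs, to apply
`B6FromB4.sandwich_decay`, which is stated for positions in a `PseudoMetricSpace`). [folklore] -/
@[reducible] noncomputable def pms (ρ : P → P → ℝ) (hρ : IsPseudoDist ρ) : PseudoMetricSpace P where
  dist := ρ
  dist_self := hρ.zero
  dist_comm := hρ.symm
  dist_triangle := hρ.triangle

/-- A LOCAL DRESSING PRESERVES THE DECAY RATE (the content of *"The formula (3.185) implies immediately bounds and an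
exponential decay"*, p. 432): if |S(u,v)| ≤ B₁e^{−δ₁ρ(u,v)}, E has range ≤ r (E(p,u) ≠ 0 ⇒ ρ(p,u) ≤ r) and row ℓ¹-sums
≤ m_E, F has range ≤ r and column ℓ¹-sums ≤ m_F, then |(ESF)(p,q)| ≤ B₁e^{2δ₁r}m_Em_F·e^{−δ₁ρ(p,q)} — the generic
sandwich `B6FromB4.sandwich_decay` ([4] p. 250) in the pseudo-metric space generated by ρ.
[cite: Balaban1985BackgroundPropagators, (3.185)+(3.187) p.432; Balaban1984PropagatorsII, p.250] -/
theorem dressed_decay (ρ : P → P → ℝ) (hρ : IsPseudoDist ρ) (E S F : Matrix P P ℝ)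
    {B₁ δ₁ r mE mF : ℝ} (hB₁ : 0 ≤ B₁) (hδ₁ : 0 ≤ δ₁)
    (hS : ∀ u v, |S u v| ≤ B₁ * Real.exp (-(δ₁ * ρ u v)))
    (hEr : ∀ p u, E p u ≠ 0 → ρ p u ≤ r) (hE1 : ∀ p, ∑ u, |E p u| ≤ mE)
    (hFr : ∀ v q, F v q ≠ 0 → ρ v q ≤ r) (hF1 : ∀ q, ∑ v, |F v q| ≤ mF) :
    ∀ p q, |(E * S * F) p q| ≤ B₁ * Real.exp (2 * δ₁ * r) * mE * mF * Real.exp (-(δ₁ * ρ p q)) := by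
  letI : PseudoMetricSpace P := pms ρ hρ
  exact B6FromB4.sandwich_decay (X := P) (fun p : P => p) (fun p : P => p) E S F hB₁ hδ₁ hEr hE1 hFr hF1 hS

/-- **(3.185) ⇒ (3.187)** (p. 432), kernel form: with S = the kernel of QG̃₂Q* on the bond set P of Λ,
|S(u,v)| ≤ B₁e^{−δ₁|u−v|} (the random-walk input), and E = the kernel of the local operator I + D̄μ ((3.169): range ≤ r,
row ℓ¹-sums ≤ m), the kernel C^{(k)}(Λ) = ESEᵀ of (3.185) satisfies |C^{(k)}(Λ)(p,q)| ≤ B₁e^{2δ₁r}m²·e^{−δ₁|p−q|}: the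
bound (3.187) with δ₀ = δ₁ and B₀ = B₁e^{2δ₁r}m² (the adjoint I + μ*D̄* is the transpose for the unit-lattice pairing;
its range and column sums are those of E by the symmetry of the distance).
[cite: Balaban1985BackgroundPropagators, (3.185)–(3.187) p.432 + (3.169) p.430] -/
theorem decay_3187_of_3185 (ρ : P → P → ℝ) (hρ : IsPseudoDist ρ) (E S : Matrix P P ℝ)
    {B₁ δ₁ r m : ℝ} (hB₁ : 0 ≤ B₁) (hδ₁ : 0 ≤ δ₁)
    (hS : ∀ u v, |S u v| ≤ B₁ * Real.exp (-(δ₁ * ρ u v)))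
    (hEr : ∀ p u, E p u ≠ 0 → ρ p u ≤ r) (hE1 : ∀ p, ∑ u, |E p u| ≤ m) :
    ∀ p q, |(E * S * Eᵀ) p q| ≤ B₁ * Real.exp (2 * δ₁ * r) * m * m * Real.exp (-(δ₁ * ρ p q)) :=
  dressed_decay ρ hρ E S Eᵀ hB₁ hδ₁ hS hEr hE1
    (fun v q h => by
      rw [hρ.symm]
      exact hEr q v (by simpa [Matrix.transpose_apply] using h))
    (fun q => by simpa [Matrix.transpose_apply] using hE1 q)

/-- DECAY ALONG AN AFFINE COMPARISON OF DISTANCES (the shape in which the distance of the extended sequence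
{Ω_j}_{j≤k+1} of p. 429 — in which the random-walk majorants of G̃₂ decay — is compared with |y − y′| on Λ): if
|S(p,q)| ≤ Be^{−δρ₁(p,q)} and cρ₂ ≤ ρ₁ + a pointwise, then |S(p,q)| ≤ Be^{δa}·e^{−cδρ₂(p,q)}. [folklore] -/
theorem decay_of_affine_comparison {ι : Type} (S : ι → ι → ℝ) (ρ₁ ρ₂ : ι → ι → ℝ) {B δ c a : ℝ}
    (hB : 0 ≤ B) (hδ : 0 ≤ δ) (hcmp : ∀ p q, c * ρ₂ p q ≤ ρ₁ p q + a)
    (hS : ∀ p q, |S p q| ≤ B * Real.exp (-(δ * ρ₁ p q))) :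
    ∀ p q, |S p q| ≤ B * Real.exp (δ * a) * Real.exp (-(δ * c * ρ₂ p q)) := by
  intro p q
  refine (hS p q).trans ?_
  rw [mul_assoc, ← Real.exp_add]
  refine mul_le_mul_of_nonneg_left (Real.exp_le_exp.mpr ?_) hB
  have h1 : δ * c * ρ₂ p q ≤ δ * ρ₁ p q + δ * a := by
    have := mul_le_mul_of_nonneg_left (hcmp p q) hδ
    rwa [mul_add, ← mul_assoc] at this
  linarith

end Dressing

/-! ## §2  (3.186) sandwiched by Q ⋯ Q*: the kernel of QG̃₂Q* from the kernels of QG₂Q*, QG₂Q̃*, (Q̃G₂Q̃*)⁻¹, Q̃G₂Q*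
through a middle carrier with a lattice-sum profile -/

section Composition

variable {P W : Type} [Fintype W]

/-- CONVOLUTION OF TWO EXPONENTIAL KERNELS, the profile consumed by the LEFT factor: if Σ_z e^{−(a−δ′)ρ(w,z)} ≤ K for
every centre w and δ′ ≤ b, 0 ≤ δ′, then Σ_z e^{−aρ(x,z)}e^{−bρ(z,y)} ≤ K·e^{−δ′ρ(x,y)} (triangle inequality:
aρ(x,z) + bρ(z,y) ≥ (a − δ′)ρ(x,z) + δ′ρ(x,y)). [folklore] -/
theorem conv_le_left (ρ : W → W → ℝ) (hρ : IsPseudoDist ρ) {a b δ' K : ℝ} (hδ'b : δ' ≤ b) (hδ' : 0 ≤ δ')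
    (hK : ∀ w : W, ∑ z : W, Real.exp (-((a - δ') * ρ w z)) ≤ K) (x y : W) :
    ∑ z : W, Real.exp (-(a * ρ x z)) * Real.exp (-(b * ρ z y)) ≤ K * Real.exp (-(δ' * ρ x y)) := by
  have hterm : ∀ z, Real.exp (-(a * ρ x z)) * Real.exp (-(b * ρ z y)) ≤
      Real.exp (-((a - δ') * ρ x z)) * Real.exp (-(δ' * ρ x y)) := by
    intro z
    rw [← Real.exp_add, ← Real.exp_add]
    apply Real.exp_le_exp.mpr
    have h1 : δ' * ρ x y ≤ δ' * ρ x z + δ' * ρ z y := by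
      have := mul_le_mul_of_nonneg_left (hρ.triangle x z y) hδ'
      rwa [mul_add] at this
    have h2 : δ' * ρ z y ≤ b * ρ z y := mul_le_mul_of_nonneg_right hδ'b (hρ.nonneg z y)
    have h3 : (a - δ') * ρ x z = a * ρ x z - δ' * ρ x z := by ring
    rw [h3]
    linarith
  calc ∑ z, Real.exp (-(a * ρ x z)) * Real.exp (-(b * ρ z y))
      ≤ ∑ z, Real.exp (-((a - δ') * ρ x z)) * Real.exp (-(δ' * ρ x y)) :=
        Finset.sum_le_sum fun z _ => hterm z
    _ = (∑ z, Real.exp (-((a - δ') * ρ x z))) * Real.exp (-(δ' * ρ x y)) := by rw [Finset.sum_mul]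
    _ ≤ K * Real.exp (-(δ' * ρ x y)) := mul_le_mul_of_nonneg_right (hK x) (Real.exp_pos _).le

/-- CONVOLUTION OF TWO EXPONENTIAL KERNELS, the profile consumed by the RIGHT factor: if Σ_z e^{−(b−δ′)ρ(w,z)} ≤ K for
every centre w and δ′ ≤ a, 0 ≤ δ′, then Σ_z e^{−aρ(x,z)}e^{−bρ(z,y)} ≤ K·e^{−δ′ρ(x,y)} (`conv_le_left` read from y, by
the symmetry of ρ). [folklore] -/
theorem conv_le_right (ρ : W → W → ℝ) (hρ : IsPseudoDist ρ) {a b δ' K : ℝ} (hδ'a : δ' ≤ a) (hδ' : 0 ≤ δ')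
    (hK : ∀ w : W, ∑ z : W, Real.exp (-((b - δ') * ρ w z)) ≤ K) (x y : W) :
    ∑ z : W, Real.exp (-(a * ρ x z)) * Real.exp (-(b * ρ z y)) ≤ K * Real.exp (-(δ' * ρ x y)) := by
  have h := conv_le_left ρ hρ (a := b) (b := a) hδ'a hδ' hK y x
  have hsw : ∑ z : W, Real.exp (-(a * ρ x z)) * Real.exp (-(b * ρ z y)) =
      ∑ z : W, Real.exp (-(b * ρ y z)) * Real.exp (-(a * ρ z x)) :=
    Finset.sum_congr rfl fun z _ => by rw [hρ.symm x z, hρ.symm z y, mul_comm]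
  rw [hsw, hρ.symm x y]
  exact h

/-- THE PRODUCT OF TWO DECAYING RECTANGULAR KERNELS THROUGH A MIDDLE CARRIER DECAYS: A : P × W, B : W × Q with
|A(p,z)| ≤ c_Ae^{−aρ(pos p,z)}, |B(z,q)| ≤ c_Be^{−bρ(z,pos′ q)} and the convolution bound Σ_z e^{−aρ(x,z)}e^{−bρ(z,y)} ≤
K·e^{−δ′ρ(x,y)} (`conv_le_left` / `conv_le_right`) give |(AB)(p,q)| ≤ c_Ac_BK·e^{−δ′ρ(pos p,pos′ q)} ([4] (2.52)/(2.55), pp. 232–233,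
in kernel language). [cite: Balaban1984PropagatorsII, (2.52)/(2.55) pp.232–233] -/
theorem mul_decay (ρ : W → W → ℝ) {Q : Type} (pos : P → W) (pos' : Q → W)
    (A : Matrix P W ℝ) (B : Matrix W Q ℝ) {cA cB a b δ' K : ℝ} (hcA : 0 ≤ cA) (hcB : 0 ≤ cB)
    (hconv : ∀ x y : W, ∑ z : W, Real.exp (-(a * ρ x z)) * Real.exp (-(b * ρ z y)) ≤ K * Real.exp (-(δ' * ρ x y)))
    (hA : ∀ p z, |A p z| ≤ cA * Real.exp (-(a * ρ (pos p) z)))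
    (hB : ∀ z q, |B z q| ≤ cB * Real.exp (-(b * ρ z (pos' q)))) :
    ∀ p q, |(A * B) p q| ≤ cA * cB * K * Real.exp (-(δ' * ρ (pos p) (pos' q))) := by
  intro p q
  rw [Matrix.mul_apply]
  calc |∑ z, A p z * B z q| ≤ ∑ z, |A p z * B z q| := Finset.abs_sum_le_sum_abs _ _
    _ ≤ ∑ z, (cA * Real.exp (-(a * ρ (pos p) z))) * (cB * Real.exp (-(b * ρ z (pos' q)))) := by
        refine Finset.sum_le_sum fun z _ => ?_
        rw [abs_mul]
        exact mul_le_mul (hA p z) (hB z q) (abs_nonneg _) (mul_nonneg hcA (Real.exp_pos _).le)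
    _ = cA * cB * ∑ z, Real.exp (-(a * ρ (pos p) z)) * Real.exp (-(b * ρ z (pos' q))) := by
        rw [Finset.mul_sum]
        exact Finset.sum_congr rfl fun z _ => by ring
    _ ≤ cA * cB * (K * Real.exp (-(δ' * ρ (pos p) (pos' q)))) :=
        mul_le_mul_of_nonneg_left (hconv (pos p) (pos' q)) (mul_nonneg hcA hcB)
    _ = cA * cB * K * Real.exp (-(δ' * ρ (pos p) (pos' q))) := by ring

/-- **(3.186) SANDWICHED BY Q ⋯ Q*, KERNEL-LEVEL BOOKKEEPING** (p. 432: *"G̃₂ = G₂ − G₂Q̃*(Q̃G₂Q̃*)^{−1}Q̃G₂"*, hence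
QG̃₂Q* = QG₂Q* − (QG₂Q̃*)(Q̃G₂Q̃*)^{−1}(Q̃G₂Q*)): if the kernels of S₁ = QG₂Q* (on P × P), A = QG₂Q̃* (P × W),
H = (Q̃G₂Q̃*)^{−1} (W × W) and B = Q̃G₂Q* (W × P) are bounded by c₁, c_A, c_H, c_B times e^{−δ·ρ} (the bonds of Λ placed in
the middle carrier W — the block set 𝔅̃ of the extended sequence of p. 429 — by `pos`), and W has the lattice-sum profile
Σ_z e^{−(δ−δ′)ρ(w,z)} ≤ K with 0 ≤ δ′ ≤ δ, then the kernel of S₁ − AHB is bounded by (c₁ + c_Ac_Hc_BK²)e^{−δ′ρ(pos p, pos q)}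
— the printed *"Expanding these into random walks we get a random walk expansion of C^{(k)}(Λ)"* at the level of
kernel bounds; the four input bounds are HYPOTHESES (random-walk content, cell GAPS G-B9-10).
[cite: Balaban1985BackgroundPropagators, (3.186) p.432; Balaban1984PropagatorsII, (2.52)/(2.55) pp.232–233 + (2.61) p.234] -/
theorem kernel_3186 (ρ : W → W → ℝ) (hρ : IsPseudoDist ρ) (pos : P → W)
    (S₁ : Matrix P P ℝ) (A : Matrix P W ℝ) (H : Matrix W W ℝ) (B : Matrix W P ℝ)
    {c₁ cA cH cB δ δ' K : ℝ} (hc₁ : 0 ≤ c₁) (hcA : 0 ≤ cA) (hcH : 0 ≤ cH) (hcB : 0 ≤ cB)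
    (hδ' : 0 ≤ δ') (hδ'δ : δ' ≤ δ)
    (hK : ∀ w : W, ∑ z : W, Real.exp (-((δ - δ') * ρ w z)) ≤ K)
    (hS₁ : ∀ p q, |S₁ p q| ≤ c₁ * Real.exp (-(δ * ρ (pos p) (pos q))))
    (hA : ∀ p z, |A p z| ≤ cA * Real.exp (-(δ * ρ (pos p) z)))
    (hH : ∀ z z', |H z z'| ≤ cH * Real.exp (-(δ * ρ z z')))
    (hB : ∀ z q, |B z q| ≤ cB * Real.exp (-(δ * ρ z (pos q)))) :
    ∀ p q, |(S₁ - A * H * B) p q| ≤ (c₁ + cA * cH * cB * K * K) * Real.exp (-(δ' * ρ (pos p) (pos q))) := by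
  have hKK : (0 : ℝ) ≤ cA * cH * cB * K * K := by
    rw [mul_assoc (cA * cH * cB)]
    exact mul_nonneg (mul_nonneg (mul_nonneg hcA hcH) hcB) (mul_self_nonneg K)
  have hexp : ∀ p q, Real.exp (-(δ * ρ (pos p) (pos q))) ≤ Real.exp (-(δ' * ρ (pos p) (pos q))) := fun p q =>
    Real.exp_le_exp.mpr (by
      have := mul_le_mul_of_nonneg_right hδ'δ (hρ.nonneg (pos p) (pos q))
      linarith)
  have hAHB : ∀ p q, |(A * H * B) p q| ≤ cA * cH * cB * K * K * Real.exp (-(δ' * ρ (pos p) (pos q))) := by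
    rcases isEmpty_or_nonempty W with hW | ⟨⟨w₀⟩⟩
    · -- the middle carrier is empty: A·H·B = 0
      intro p q
      have h0 : (A * H * B) p q = 0 := by simp [Matrix.mul_apply]
      rw [h0, abs_zero]
      exact mul_nonneg hKK (Real.exp_pos _).le
    · have hK0 : 0 ≤ K := (Finset.sum_nonneg fun z _ => (Real.exp_pos _).le).trans (hK w₀)
      -- A·H decays at the rate δ′ (profile consumed on the left)
      have hAH : ∀ p z', |(A * H) p z'| ≤ cA * cH * K * Real.exp (-(δ' * ρ (pos p) z')) :=
        mul_decay ρ pos (fun z : W => z) A H hcA hcH (conv_le_left ρ hρ (a := δ) (b := δ) hδ'δ hδ' hK) hA hH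
      -- (A·H)·B decays at the rate δ′ (profile consumed on the right)
      have h := mul_decay ρ pos pos (A * H) B (mul_nonneg (mul_nonneg hcA hcH) hK0) hcB
        (conv_le_right ρ hρ (a := δ') (b := δ) le_rfl hδ' hK) hAH hB
      intro p q
      have hc : cA * cH * K * cB * K = cA * cH * cB * K * K := by ring
      rw [← hc]
      exact h p q
  intro p q
  rw [Matrix.sub_apply]
  calc |S₁ p q - (A * H * B) p q| ≤ |S₁ p q| + |(A * H * B) p q| := abs_sub _ _
    _ ≤ c₁ * Real.exp (-(δ' * ρ (pos p) (pos q))) + cA * cH * cB * K * K * Real.exp (-(δ' * ρ (pos p) (pos q))) :=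
        add_le_add ((hS₁ p q).trans (mul_le_mul_of_nonneg_left (hexp p q) hc₁)) (hAHB p q)
    _ = (c₁ + cA * cH * cB * K * K) * Real.exp (-(δ' * ρ (pos p) (pos q))) := by ring

end Composition

/-! ## §3  The edge into the typed Theorem 3.15 (`B9.Thm315Printed`) -/

section Edge

/-- THE DATA OF (3.185) AT ONE CONFIGURATION U (readings (a)–(d) of the header, as ONE `Prop`): a finite bond set P
mapped by e ONTO the sites of Λ (`inΛ`), on which |y − y′| (`unitDist`) is a pseudo-distance; the kernel identity
C^{(k)}(Λ)(e p, e q) = (ESEᵀ)(p, q) ((3.185): E = I + D̄μ, S = QG̃₂Q*); the random-walk bound |S(p,q)| ≤ B₁e^{−δ₁|e p − e q|}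
(HYPOTHESIS, G-B9-10); the locality of E from (3.169): range ≤ r, row ℓ¹-sums ≤ m.
[cite: Balaban1985BackgroundPropagators, (3.185) p.432 + (3.169) p.430] -/
def Rep3185 (g : B9.Geometry) (B : B9.Backgrounds) (Ck : B9.SiteKernel g B) (inΛ : g.Site → Prop)
    (unitDist : g.Site → g.Site → ℝ) (U : B.Cfg) (δ₁ B₁ r m : ℝ) : Prop :=
  ∃ (P : Type) (_ : Fintype P) (e : P → g.Site) (E S : Matrix P P ℝ),
    (∀ y, inΛ y → ∃ p, e p = y) ∧
    IsPseudoDist (fun p q => unitDist (e p) (e q)) ∧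
    (∀ p q, Ck.ker U (e p) (e q) = (E * S * Eᵀ) p q) ∧
    (∀ p q, |S p q| ≤ B₁ * Real.exp (-(δ₁ * unitDist (e p) (e q)))) ∧
    (∀ p q, E p q ≠ 0 → unitDist (e p) (e q) ≤ r) ∧
    (∀ p, ∑ q, |E p q| ≤ m)

/-- (3.185) data at U ⇒ the inequality (3.187) at U with δ₀ = δ₁ and B₀ = B₁e^{2δ₁r}m² (`decay_3187_of_3185` read on the
sites of Λ through e). [cite: Balaban1985BackgroundPropagators, (3.185)–(3.187) p.432] -/
theorem bound_of_rep3185 {g : B9.Geometry} {B : B9.Backgrounds} {Ck : B9.SiteKernel g B} {inΛ : g.Site → Prop}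
    {unitDist : g.Site → g.Site → ℝ} {U : B.Cfg} {δ₁ B₁ r m : ℝ} (hB₁ : 0 ≤ B₁) (hδ₁ : 0 ≤ δ₁)
    (h : Rep3185 g B Ck inΛ unitDist U δ₁ B₁ r m) :
    ∀ y y', inΛ y → inΛ y' →
      |Ck.ker U y y'| ≤ B₁ * Real.exp (2 * δ₁ * r) * m * m * Real.exp (-(δ₁ * unitDist y y')) := by
  intro y y' hy hy'
  obtain ⟨P, instP, e, E, S, hcov, hρ, hfac, hS, hEr, hE1⟩ := h
  obtain ⟨p, rfl⟩ := hcov y hy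
  obtain ⟨q, rfl⟩ := hcov y' hy'
  rw [hfac]
  exact decay_3187_of_3185 (fun p q => unitDist (e p) (e q)) hρ E S hB₁ hδ₁ hS hEr hE1 p q

/-- THE (3.185) DATA UNDER THE QUANTIFIER PREFIX OF THE TYPED THEOREM 3.15: for every instance i, every α₀ > 0 with
Mα₀ ≤ a₀ (*"For Mα₀ sufficiently small"*) and every configuration U with (3.35)–(3.36), the data `Rep3185` with constants
(δ₁, B₁, r, m) UNIFORM in i and U (*"depending on d and L only"*).
[cite: Balaban1985BackgroundPropagators, Thm 3.15 p.432] -/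
def Hyp3185 {I : Type} (c35 : ℝ) (geo : I → B9.Geometry) (bg : I → B9.Backgrounds)
    (Ck : ∀ i, B9.SiteKernel (geo i) (bg i)) (inΛ : ∀ i, (geo i).Site → Prop)
    (unitDist : ∀ i, (geo i).Site → (geo i).Site → ℝ) (a₀ δ₁ B₁ r m : ℝ) : Prop :=
  ∀ i : I, ∀ α₀ : ℝ, 0 < α₀ → (geo i).M * α₀ ≤ a₀ →
    ∀ U : (bg i).Cfg, (bg i).Reg335 c35 α₀ U → (bg i).Reg336 c35 α₀ U →
      Rep3185 (geo i) (bg i) (Ck i) (inΛ i) (unitDist i) U δ₁ B₁ r m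

/-- **THE EDGE INTO THE TYPED THEOREM 3.15** (the paper's proof structure, p. 432: (3.185) + the random-walk bound of
QG̃₂Q* + the locality of I + D̄μ ⇒ (3.187)): uniform (3.185) data `Hyp3185 … a₀ δ₁ B₁ r m` with a₀, δ₁, B₁, m > 0 give
r1's `B9.Thm315Printed` with the witnesses δ₀ = δ₁, a₀, B₀ = B₁e^{2δ₁r}m².  The random-walk bound inside `Hyp3185` is the
OPEN input (cell GAPS G-B9-10). [cite: Balaban1985BackgroundPropagators, Thm 3.15 (3.185)–(3.187) p.432] -/
theorem thm315Printed_of_3185 {I : Type} (c35 : ℝ) (geo : I → B9.Geometry) (bg : I → B9.Backgrounds)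
    (Ck : ∀ i, B9.SiteKernel (geo i) (bg i)) (inΛ : ∀ i, (geo i).Site → Prop)
    (unitDist : ∀ i, (geo i).Site → (geo i).Site → ℝ) {a₀ δ₁ B₁ r m : ℝ}
    (ha₀ : 0 < a₀) (hδ₁ : 0 < δ₁) (hB₁ : 0 < B₁) (hm : 0 < m)
    (h : Hyp3185 c35 geo bg Ck inΛ unitDist a₀ δ₁ B₁ r m) :
    B9.Thm315Printed c35 geo bg Ck inΛ unitDist := by
  refine ⟨δ₁, a₀, B₁ * Real.exp (2 * δ₁ * r) * m * m, hδ₁, ha₀,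
    mul_pos (mul_pos (mul_pos hB₁ (Real.exp_pos _)) hm) hm, ?_⟩
  intro i α₀ hα hMa U h35 h36 y y' hy hy'
  exact bound_of_rep3185 hB₁.le hδ₁.le (h i α₀ hα hMa U h35 h36) y y' hy hy'

end Edge

end Literature.MathematicalPhysics.QuantumFieldTheory.Balaban1983to89.B9Thm315Decay
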